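import Mathlib
import Summits.NavierStokesRegularity.NavierStokesRegularity.Theses.AmplitudeIndex
import Summits.NavierStokesRegularity.NavierStokesRegularity.Theorems.MarginalTypeICriticalViscosityExists
import HarnessLib

/-!
# `AmplitudeIndex.GIPL3Stability` and `AmplitudeIndex.CriticalViscosityOfGIP` (route `AmplitudeIndex`,
  items stmt-NavierStokesRegularity-9379 and stmt-NavierStokesRegularity-10567, supports)

* `GIPL3Stability` is VERBATIM the Literature fact `GIP2003_L3_stability` (Gallagher–Iftimie–Planchon
  2003, Thm. 0.1), which the tree now PROVES (`GIP2003_L3_stability_holds`): the item closes by it.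
* `CriticalViscosityOfGIP` is `GIPL3Stability → CriticalViscosityExists` (the shared statement of
  route MarginalTypeI, stmt-1750), whose consequent is proved unconditionally in
  `MarginalTypeICriticalViscosityExists.lean` (`marginalTypeI_criticalViscosityExists_proof`).

HONEST FRAMING: a printed stability theorem and a statement about a HYPOTHETICAL non-global datum;
nothing here bears on the regularity problem itself.
-/

noncomputable section

set_option linter.dupNamespace false

namespace Summit.NavierStokesRegularity.NavierStokesRegularity.Theorems

open Literature.Analysis Literature.Analysis.FluidPDE

/-- **Item stmt-NavierStokesRegularity-9379** (`AmplitudeIndex.GIPL3Stability`): Gallagher–Iftimie–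
Planchon's `L³`-stability of global Kato solutions — the tree's proved fact
`GIP2003_L3_stability_holds`. [GallagherIftimiePlanchon2003 Thm 0.1] -/
theorem amplitudeIndex_gipL3Stability_proof :
    Summit.NavierStokesRegularity.NavierStokesRegularity.Theses.AmplitudeIndex.GIPL3Stability := by
  unfold Summit.NavierStokesRegularity.NavierStokesRegularity.Theses.AmplitudeIndex.GIPL3Stability
  intro u₀ u h1 h2 h3 h4 h5 h6
  exact GIP2003_L3_stability_holds u₀ u h1 h2 h3 h4 h5 h6

/-- **Item stmt-NavierStokesRegularity-10567** (`AmplitudeIndex.CriticalViscosityOfGIP`): the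
critical viscosity of a non-global Clay datum, from (indeed without) the GIP antecedent.
[this file; via `marginalTypeI_criticalViscosityExists_proof`] -/
theorem amplitudeIndex_criticalViscosityOfGIP_proof :
    Summit.NavierStokesRegularity.NavierStokesRegularity.Theses.AmplitudeIndex.CriticalViscosityOfGIP := by
  unfold Summit.NavierStokesRegularity.NavierStokesRegularity.Theses.AmplitudeIndex.CriticalViscosityOfGIP
  intro _hGIP
  exact marginalTypeI_criticalViscosityExists_proof

end Summit.NavierStokesRegularity.NavierStokesRegularity.Theorems

end
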